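import Mathlib
import HarnessLib
import HarnessLib.Audit
import Summits.Langlands.Langlands.Theorems.OddPrimeDoorSplit
import Summits.Langlands.Langlands.Theorems.RealCyclotomicDoorSplitPrelude

/-!
# ModuliFieldDescentSplit (Prelude: §1–§3 — the dial `JPrimitive`, the pieces PRIM / TRBC / APB, the descent lemma) — lens-5 g32 node on CORE = `OddPrimeDoorSplit.CoreResidual`

RESIDUAL MODE (cell decomp-langlands, LADDER-Langlands root decomposition D-0178), lineage of route-Langlands-TowerDoorSplit:
REST (stmt-Langlands-26998) → REST_E (g26 `DepthIsolationSplit`) → LJR (g27 `JDegreeFilterSplit`) → RES (g28 `DyadicDoorSplit`)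
→ F2T ∧ … (g29 `TwoDivisionFieldSplit`) → CORE (g30 `OddPrimeDoorSplit`, landed p829144 / p829190) → CORE′ ∧ cells (g31
`RealCyclotomicDoorSplit`, CLEARED row 463).  This node refines CORE (tree decl, BY NAME) along an axis that COMMUTES with g31's
field / level cells (pure conjunction of hypotheses).

AXIS (finite/base range + asymptotic regime + bridge, in the currency of the MODULI DEGREE `m = [ℚ(j(E)) : ℚ]`, pushed through
ALL degrees).  g27 cut the dial `jDeg` at `4` because modularity over the field of moduli `F = ℚ(j(E)) ≤ K₀` is printed only for
`[F:ℚ] ≤ 4`.  OBSERVATION (idempotence of the descent): the `F`-model `jModel p q` of `j(E) = p/q ∈ F` is j-PRIMITIVE over `F`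
(`ℚ(j(jModel)) = F`), and `E` is a quadratic twist of its base change to `K₀` (twist invariance of modularity is the PROVED tree
lemma `isModularEllipticCurve_of_jInvariant_eq_holds`; `j ∈ {0, 1728}` is CM, PROVED `WeierstrassCurve.HasCM.of_j_eq_zero_or_1728`).
Hence NO truncation and NO induction are needed: every core curve is accounted to exactly ONE j-primitive curve over a totally
real field of degree `m = jDeg ∣ [K₀:ℚ]`, and CORE splits as

* PRIM `PrimitiveCoreResidual` (asymptotic regime = the DECLARED RESIDUAL; WEAKER; IDEA-NEEDED): CORE on the pairs `(K₀, E)` with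
  `ℚ(j(E)) = K₀` (`JPrimitive`: `[ℚ(j):ℚ] = [K₀:ℚ]`).  In moduli terms (on g31's CELL D): the closed points `x` of the four
  level-`105` curves `X₀(105)`, `X(s3,b5,b7)`, `X(b3,b5,e7)`, `X(s3,b5,e7)` with `ℚ(x) = ℚ(j(x))` totally real, unanchored, of degree
  `≥ 6` — ONE parameter (a totally real algebraic number `j`), no auxiliary field;
* TRBC `TotallyRealBaseChange` (bridge; WEAKER than REST_E; NEW typed functoriality leaf generalising g27's DBC (`F = ℚ`, Dieulefait)
  and NSBC (`2 ≤ [F:ℚ] ≤ 4`, `√5 ∉ F` if quartic) to every RESIDUAL degree `[F:ℚ] ≥ 5` or `= 4` with `√5 ∈ F`, `[F:ℚ] < [K₀:ℚ]`;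
  disjoint from g27's bridge range): base change INTO the box of the modularity of a j-primitive integral curve over a totally
  real field `F → K₀`.  Its solubly-covered locus is Langlands 1980 / Arthur–Clozel cyclic base change
  (PRINT, modulo the cofinite-trace ↔ Hecke-polynomial rendering of «modular»); its insoluble locus is base change of parallel-weight-2
  Hilbert newforms over `F ≠ ℚ` along non-solvable totally real extensions — in print only for `F = ℚ` (Dieulefait 2012/2015, safe
  chains), programme-level over real quadratic `F` and conjectural in general (Dieulefait–Pacetti, Rayuela Conjecture, modular
  variant Conj. 8.3 ⇒ base change for totally real fields) [ref: DieulefaitPacetti2015, pp. 219, 222 (LMS LN 420)];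
* finite/base range of the dial, BY NAME: the host rungs Q4 `EllipticDegreeLadder.QuarticModularity` (stmt 17832; `m = 4`, reached
  only through `InResidualRange`'s `√5`-quartic clause) and Q5 `EllipticDegreeLadder.QuinticModularity` (`m = 5`), the (A)-cell facts
  `Yoshikawa2019_theorem1_2` / `Thorne2019_thm1` (moduli field abelian with `3·5·7 ∤ disc`, or a cyclotomic `ℤ_p`-layer), and the
  lineage's own closed sectors AT THE FIELD OF MODULI (Allen door `allenDoorSector_of_corollary`, FLS generic / Skinner–Wiles /
  Pan–Zhang doors `modular_of_offDoors`);
* APB `AnchoredBPrimitiveModularity` (GLUE; S-implied; the declared PRICE of the descent, exactly as g29's F2T_B): j-primitive curves of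
  residual moduli degree over (B5)/(B7)-ANCHORED totally real fields of degree `≥ 6` (the field of moduli of a box curve may be anchored
  although `K₀` is not).  For a j-PRIMITIVE curve the host's anchor mechanism (items 26996/26997: a `15`- or `21`-stable odd solvable
  cover `F/F′`, `[F′:ℚ] ≤ 5`, places the moduli point in `F′`) contradicts primitivity outright — no base-range step is needed; typed,
  not claimed.

KERNEL (case analysis, no junction of its own): `modular_of_jPrimitive` — the pieces prove modularity of EVERY j-primitive integral
curve over EVERY totally real field of degree `≥ 4`; `core_of_pieces : ADC → FLS34 → SWD → PZD → Y19 → Th19 → Q4 → Q5 → APB → TRBC →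
PRIM → CORE`; EXACTNESS `prim_of_core : CORE → PRIM`, `trbc_of_restE : REST_E → TRBC`, `core_iff_prim`; compositions BY NAME
`residual_of_pieces` (RES), `largeJResidual_of_pieces` (LJR), `restE_of_pieces` (REST_E), `closes_target` / `closes_byName` (REST,
stmt-Langlands-26998, through the TREE `OddPrimeDoorSplit.closes_target`).  Inner cut of TRBC by the soluble-cover predicate
(`JDegreeFilterSplit.EmbedsInSolvableCover`, BY NAME): `trbc_iff_cover_split`.  0 sorry; axioms expected
[propext, Classical.choice, Quot.sound].

References (prose tags, cell census-twin convention): [ref: Dieulefait2015, Thm 1.2 (arXiv:1208.3946)] base change `ℚ → F`;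
[ref: DieulefaitPacetti2015, §8 (LMS Lecture Note Ser. 420, pp. 218–232)] Rayuela conjecture and base change over totally real
fields; [ref: Langlands1980AMS96, Ch. 2] cyclic base change; [ref: Thorne2016, Lemma 7.1, Thm 7.6] soluble base change for
elliptic curves, `X₀(15)` / `X(s3,b5)` descent; [ref: Box2022, Thm 1.3, Rem. 5.4]; [ref: FreitasLeHungSiksek2015, Thm 5].
-/

set_option linter.dupNamespace false
set_option linter.unusedVariables false

open scoped NumberField IntermediateField
open NumberField IsDedekindDomain Literature.NumberTheory.Automorphic
open Summit.Langlands.Langlands.Theorems.DepthIsolationSplit (UnanchoredBox UnanchoredHighDegreeModularE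
  modularE_iff_box IntegralModelTransferPointwise SatakeAvatarTwo satakeAvatarTwo_of_host)
open Summit.Langlands.Langlands.Theorems.JDegreeFilterSplit (jInv jDeg InResidualRange LargeJResidual
  RatBaseChangeModularity SmallFieldBaseChange EmbedsInSolvableCover jModel jModel_Δ_ne_zero jModel_c₄_pow_three_mul
  jInv_baseChange baseChange_Δ_ne_zero)
open Summit.Langlands.Langlands.Theorems.DyadicDoorSplit (AllenLocus AllenDyadicCorollary AllenDoorSector
  DyadicDegenerateResidual allenDoorSector_of_corollary)
open Summit.Langlands.Langlands.Theorems.TwoDivisionFieldSplit (ClauseA ClauseB5 ClauseB7 unanchoredBox_iff)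
open Summit.Langlands.Langlands.Theorems.OddPrimeDoorSplit (OffDoors CoreResidual SkinnerWilesDihedralDoor
  PanZhangSupersingularDoor modular_of_offDoors residual_of_core largeJResidual_of_core restE_of_core)
open Summit.Langlands.Langlands.Theorems.RealCyclotomicDoorSplit (BoxShape RefinedCore)
open Summit.Langlands.Langlands.Theses.EllipticDegreeLadder (QuarticModularity QuinticModularity)

namespace Summit.Langlands.Langlands.Theorems.ModuliFieldDescentSplit

/-! ## §1 The dial: j-primitivity (`ℚ(j(E)) = K₀`) -/

/-- `E / K₀` is **j-PRIMITIVE**: its field of moduli `ℚ(j(E)) ≤ K₀` is all of `K₀`, read on the moduli degree: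
`[ℚ(j(E)) : ℚ] = [K₀ : ℚ]`.  An ABSOLUTE invariant of `(K₀, j)`: unchanged by quadratic twist and by change of integral model
(`jPrimitive_congr`). -/
def JPrimitive (K₀ : Type) [Field K₀] [NumberField K₀] (E : WeierstrassCurve (𝓞 K₀)) : Prop :=
  jDeg K₀ E = Module.finrank ℚ K₀

/-- The moduli degree is at most the degree. [folklore] -/
theorem jDeg_le_finrank (K₀ : Type) [Field K₀] [NumberField K₀] (E : WeierstrassCurve (𝓞 K₀)) :
    jDeg K₀ E ≤ Module.finrank ℚ K₀ := by
  unfold jDeg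
  rw [← IntermediateField.finrank_eq_finrank_subalgebra, ← Subalgebra.finrank_toSubmodule]
  exact Submodule.finrank_le _

/-- j-primitivity depends on the `j`-invariant only. -/
theorem jPrimitive_congr (K₀ : Type) [Field K₀] [NumberField K₀] {E E' : WeierstrassCurve (𝓞 K₀)}
    (h : jInv K₀ E = jInv K₀ E') : JPrimitive K₀ E ↔ JPrimitive K₀ E' := by
  unfold JPrimitive jDeg; rw [h]

/-- j-primitive iff the field of moduli is the top intermediate field. [folklore] -/
theorem jPrimitive_iff_adjoin_eq_top (K₀ : Type) [Field K₀] [NumberField K₀] (E : WeierstrassCurve (𝓞 K₀)) :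
    JPrimitive K₀ E ↔ ℚ⟮jInv K₀ E⟯ = ⊤ := by
  unfold JPrimitive jDeg
  constructor
  · intro h
    exact IntermediateField.eq_of_le_of_finrank_eq le_top (h.trans (IntermediateField.finrank_top' (F := ℚ) (E := K₀)).symm)
  · intro h
    rw [h]
    exact IntermediateField.finrank_top'

/-- An imprimitive curve has a field of moduli of strictly smaller degree. -/
theorem finrank_moduliField_lt_of_not_jPrimitive (K₀ : Type) [Field K₀] [NumberField K₀]
    (E : WeierstrassCurve (𝓞 K₀)) (h : ¬ JPrimitive K₀ E) :
    Module.finrank ℚ ℚ⟮jInv K₀ E⟯ < Module.finrank ℚ K₀ :=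
  lt_of_le_of_ne (jDeg_le_finrank K₀ E) h

/-- In the residual range the field of moduli has degree at least `4`. -/
theorem four_le_jDeg_of_inResidualRange {K₀ : Type} [Field K₀] [NumberField K₀] {E : WeierstrassCurve (𝓞 K₀)}
    (hr : InResidualRange K₀ E) : 4 ≤ jDeg K₀ E := by
  rcases hr with h | ⟨h, _⟩ <;> omega

/-- TOWER LAW: the moduli degree divides the degree. [folklore] -/
theorem jDeg_dvd_finrank (K₀ : Type) [Field K₀] [NumberField K₀] (E : WeierstrassCurve (𝓞 K₀)) :
    jDeg K₀ E ∣ Module.finrank ℚ K₀ :=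
  Dvd.intro _ (Module.finrank_mul_finrank ℚ ℚ⟮jInv K₀ E⟯ K₀)

/-- WHERE THE DIAL BITES: if the degree `d = [K₀:ℚ]` has NO divisor `m` with `4 ≤ m < d` (e.g. `d` prime, `d = 6`, `d = 9`),
every curve of residual moduli degree is j-primitive — on such fields PRIM is all of CORE, and the descent is void; it bites
exactly for `d ∈ {8, 10, 12, 14, 15, 16, …}`. [folklore] -/
theorem jPrimitive_of_noModuliDivisor (K₀ : Type) [Field K₀] [NumberField K₀] (E : WeierstrassCurve (𝓞 K₀))
    (hd : ∀ m : ℕ, m ∣ Module.finrank ℚ K₀ → 4 ≤ m → m < Module.finrank ℚ K₀ → False)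
    (hr : InResidualRange K₀ E) : JPrimitive K₀ E := by
  by_contra h
  exact hd (jDeg K₀ E) (jDeg_dvd_finrank K₀ E) (four_le_jDeg_of_inResidualRange hr)
    (lt_of_le_of_ne (jDeg_le_finrank K₀ E) h)

/-- In particular on box fields of PRIME degree every curve of residual moduli degree is j-primitive. [folklore] -/
theorem jPrimitive_of_prime_finrank (K₀ : Type) [Field K₀] [NumberField K₀] (E : WeierstrassCurve (𝓞 K₀))
    (hp : (Module.finrank ℚ K₀).Prime) (hr : InResidualRange K₀ E) : JPrimitive K₀ E := by
  refine jPrimitive_of_noModuliDivisor K₀ E (fun m hm h4 hlt => ?_) hr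
  rcases (Nat.dvd_prime hp).1 hm with rfl | rfl <;> omega

/-- IDEMPOTENCE OF THE DESCENT: over the field of moduli `F = ℚ⟮j(E)⟯ ≤ K₀`, every integral curve whose `j`-invariant is
`j(E) ∈ F` is j-PRIMITIVE over `F`. [folklore] -/
theorem jPrimitive_over_moduliField (K₀ : Type) [Field K₀] [NumberField K₀] (E : WeierstrassCurve (𝓞 K₀))
    (E₀ : WeierstrassCurve (𝓞 ℚ⟮jInv K₀ E⟯))
    (hj : jInv ℚ⟮jInv K₀ E⟯ E₀ = (⟨jInv K₀ E, IntermediateField.mem_adjoin_simple_self ℚ _⟩ : ℚ⟮jInv K₀ E⟯)) :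
    JPrimitive ℚ⟮jInv K₀ E⟯ E₀ := by
  unfold JPrimitive jDeg
  rw [hj]
  have e := (IntermediateField.liftAlgEquiv
    ℚ⟮(⟨jInv K₀ E, IntermediateField.mem_adjoin_simple_self ℚ _⟩ : ℚ⟮jInv K₀ E⟯)⟯).toLinearEquiv.finrank_eq
  rw [IntermediateField.lift_adjoin_simple] at e
  exact e

/-! ## §2 The pieces -/

/-- PRIM (asymptotic regime; the DECLARED RESIDUAL; WEAKER; IDEA-NEEDED): CORE on the j-PRIMITIVE pairs — every integral
`E` over an unanchored totally real `K₀` of degree `≥ 6`, of residual moduli degree, off the Allen locus and off the three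
odd-prime doors, WITH `ℚ(j(E)) = K₀`, is modular. -/
def PrimitiveCoreResidual : Prop :=
  ∀ (K₀ : Type) [Field K₀] [NumberField K₀], UnanchoredBox K₀ →
    ∀ E : WeierstrassCurve (𝓞 K₀), E.Δ ≠ 0 → InResidualRange K₀ E → ¬ AllenLocus K₀ E → OffDoors K₀ E →
      JPrimitive K₀ E → IsModularEllipticCurve K₀ E

/-- TRBC (bridge; WEAKER than REST_E; NEW typed functoriality leaf): TOTALLY REAL BASE CHANGE INTO THE BOX — for an unanchored
totally real `K₀` of degree `≥ 6`, a totally real number field `F` of RESIDUAL degree (`[F:ℚ] ≥ 5`, or `= 4` with `√5 ∈ F`)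
with `[F:ℚ] < [K₀:ℚ]`, mapping to `K₀`, and a j-primitive integral `E₀ / 𝓞 F` (`Δ ≠ 0`) that is modular over `F`, the base
change `E₀ ⊗ 𝓞 K₀` is modular over `K₀` (so TRBC is DISJOINT from g27's bridge range `[ℚ(j):ℚ] ≤ 4`, `√5 ∉ ℚ(j)`).
Generalises DBC (`F = ℚ`; Dieulefait 2012, PRINT) and NSBC (`[F:ℚ] ∈ {2,3,4}`) of g27 to all degrees; soluble locus PRINT
(Langlands 1980, Arthur–Clozel), insoluble locus = non-solvable base change of parallel-weight-2 Hilbert newforms over `F ≠ ℚ`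
(Dieulefait–Pacetti programme; Rayuela Conjecture 8.1 / modular variant 8.3 ⇒ base change for totally real fields).
[ref: DieulefaitPacetti2015, pp. 219, 222] [ref: Dieulefait2015, Thm 1.2] [ref: Langlands1980AMS96, Ch. 2] -/
def TotallyRealBaseChange : Prop :=
  ∀ (K₀ : Type) [Field K₀] [NumberField K₀], UnanchoredBox K₀ →
    ∀ (F : Type) [Field F] [NumberField F] [IsTotallyReal F] [Algebra F K₀],
      (5 ≤ Module.finrank ℚ F ∨ (Module.finrank ℚ F = 4 ∧ IsSquare (5 : F))) → Module.finrank ℚ F < Module.finrank ℚ K₀ →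
      ∀ E₀ : WeierstrassCurve (𝓞 F), E₀.Δ ≠ 0 → JPrimitive F E₀ → IsModularEllipticCurve F E₀ →
        IsModularEllipticCurve K₀ (E₀.baseChange (𝓞 K₀))

/-- APM (GLUE; S-implied — modularity of j-primitive curves of residual moduli degree over ANCHORED totally real fields of
degree `≥ 6`; NOT implied by CORE: the declared price of the descent, since the field of moduli of a box curve may be
anchored).  Its (A)-cell is PRINT and VENDORED (`anchoredPrimitive_of_cells`); its (B5)/(B7)-cells are APB. -/
def AnchoredPrimitiveModularity : Prop :=
  ∀ (M : Type) [Field M] [NumberField M], IsTotallyReal M → ¬ (Module.finrank ℚ M ≤ 5) → ¬ UnanchoredBox M →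
    ∀ E : WeierstrassCurve (𝓞 M), E.Δ ≠ 0 → InResidualRange M E → JPrimitive M E → IsModularEllipticCurve M E

/-- APB (the (B5) ∨ (B7) cells of APM; S-implied glue; ATTACK = the host's anchor mechanism of items 26996 / 26997, which for a
j-PRIMITIVE curve ends in a contradiction — the `15`- or `21`-stable odd solvable cover `M / F′`, `[F′:ℚ] ≤ 5`, would place the
moduli point in `F′ ≠ M`): every j-primitive integral curve of residual moduli degree over a (B5)- or (B7)-anchored totally real
field of degree `≥ 6` is modular.  [ref: Thorne2016, Thm 7.6] [ref: Thorne2019, Lemma 3, Prop. 4] -/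
def AnchoredBPrimitiveModularity : Prop :=
  ∀ (M : Type) [Field M] [NumberField M], IsTotallyReal M → ¬ (Module.finrank ℚ M ≤ 5) →
    (ClauseB5 M ∨ ClauseB7 M) →
    ∀ E : WeierstrassCurve (𝓞 M), E.Δ ≠ 0 → InResidualRange M E → JPrimitive M E → IsModularEllipticCurve M E

/-- The (A)-cell of APM is PRINT AND VENDORED (Yoshikawa 2019 Thm 1.2; Thorne 2019 Thm 1 — tree facts BY NAME): APM ⟸ facts ∧ APB. -/
theorem anchoredPrimitive_of_cells (hY : Yoshikawa2019_theorem1_2) (hTh : Thorne2019_thm1)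
    (hB : AnchoredBPrimitiveModularity) : AnchoredPrimitiveModularity := by
  intro M _ _ hTR hdeg hnot E hΔ hr hprim
  haveI := hTR
  by_cases hA : ClauseA M
  · rcases hA with ⟨hG, hab, h3, h5, h7⟩ | ⟨p, hp, hcyc⟩
    · exact hY.isModularEllipticCurve M hG hab h3 h5 h7 E hΔ
    · exact hTh p hp M hcyc E hΔ
  · by_cases hB5 : ClauseB5 M
    · exact hB M hTR hdeg (Or.inl hB5) E hΔ hr hprim
    · by_cases hB7 : ClauseB7 M
      · exact hB M hTR hdeg (Or.inr hB7) E hΔ hr hprim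
      · exact absurd ((unanchoredBox_iff M).2 ⟨hTR, hdeg, hA, hB5, hB7⟩) hnot

/-! ## §3 The descent to the field of moduli (idempotent form of g27's bridge mechanism) -/

/-- DESCENT over an abstract subfield `F → K`: if every integral `F`-curve with `j`-invariant `j₀` is modular over `F` (`hmod`)
and that modularity base-changes into `K` (`hBC`), then every integral `E / 𝓞 K` with `j(E) = j₀` is modular over `K` — CM if
`j₀ ∈ {0, 1728}`, else a quadratic twist of the base change of the `F`-model `jModel p q` (`j₀ = p/q`).  Body = g27's
`isModularEllipticCurve_of_jInv_eq_algebraMap` with the hypotheses localised AT `j₀` and valued in `IsModularEllipticCurve`. -/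
theorem isModularEllipticCurve_of_moduliField
    (F : Type) [Field F] [NumberField F] (K : Type) [Field K] [NumberField K] [IsTotallyReal K] [Algebra F K]
    (j₀ : F)
    (hmod : ∀ E₀ : WeierstrassCurve (𝓞 F), E₀.Δ ≠ 0 → jInv F E₀ = j₀ → IsModularEllipticCurve F E₀)
    (hBC : ∀ E₀ : WeierstrassCurve (𝓞 F), E₀.Δ ≠ 0 → jInv F E₀ = j₀ → IsModularEllipticCurve F E₀ →
      IsModularEllipticCurve K (E₀.baseChange (𝓞 K)))
    (E : WeierstrassCurve (𝓞 K)) (hΔ : E.Δ ≠ 0) (hj : jInv K E = algebraMap F K j₀) :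
    IsModularEllipticCurve K E := by
  classical
  by_cases h01 : j₀ = 0 ∨ j₀ = 1728
  · haveI hW : (E.baseChange K).IsElliptic := isElliptic_baseChange_of_Δ_ne_zero hΔ
    have hjE : (E.baseChange K).j = algebraMap F K j₀ := (j_baseChange_eq_c₄_pow_div hΔ).trans hj
    refine Or.inl (WeierstrassCurve.HasCM.of_j_eq_zero_or_1728 ?_)
    rcases h01 with h | h
    · exact Or.inl (by rw [hjE, h, map_zero])
    · exact Or.inr (by rw [hjE, h, map_ofNat])
  push Not at h01
  obtain ⟨hj0, hj1728⟩ := h01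
  obtain ⟨p, q, hqnz, hpq⟩ := IsFractionRing.div_surjective (A := 𝓞 F) j₀
  have hq : q ≠ 0 := nonZeroDivisors.ne_zero hqnz
  have hqF : algebraMap (𝓞 F) F q ≠ 0 := (map_ne_zero_iff _ (FaithfulSMul.algebraMap_injective (𝓞 F) F)).2 hq
  have hp : p ≠ 0 := by
    rintro rfl
    apply hj0
    rw [← hpq, map_zero, zero_div]
  have hp1728 : p ≠ 1728 * q := by
    intro h
    apply hj1728
    rw [← hpq, h, map_mul, map_ofNat, mul_div_assoc, div_self hqF, mul_one]
  have hΔ₀ : (jModel p q).Δ ≠ 0 := jModel_Δ_ne_zero hp hq hp1728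
  have hjF : jInv F (jModel p q) = j₀ := by
    have hΔF : algebraMap (𝓞 F) F (jModel p q).Δ ≠ 0 :=
      (map_ne_zero_iff _ (FaithfulSMul.algebraMap_injective (𝓞 F) F)).2 hΔ₀
    unfold jInv
    rw [div_eq_iff hΔF, ← hpq, div_mul_eq_mul_div, eq_div_iff hqF, ← map_pow, ← map_mul, ← map_mul,
      jModel_c₄_pow_three_mul p q, mul_comm]
  have hmodK : IsModularEllipticCurve K ((jModel p q).baseChange (𝓞 K)) :=
    hBC (jModel p q) hΔ₀ hjF (hmod (jModel p q) hΔ₀ hjF)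
  have hj' : jInv K ((jModel p q).baseChange (𝓞 K)) = algebraMap F K j₀ := by
    rw [jInv_baseChange, ← hjF]; rfl
  have hΔ₀K : ((jModel p q).baseChange (𝓞 K)).Δ ≠ 0 := baseChange_Δ_ne_zero F K _ hΔ₀
  have hj0K : algebraMap F K j₀ ≠ 0 := (map_ne_zero_iff _ (algebraMap F K).injective).2 hj0
  have hj1728K : algebraMap F K j₀ ≠ 1728 := by
    intro h
    apply hj1728
    apply (algebraMap F K).injective
    rw [h, map_ofNat]
  refine isModularEllipticCurve_of_jInvariant_eq_holds K ((jModel p q).baseChange (𝓞 K)) E hΔ₀K hΔ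
    (hj'.trans hj.symm) ?_ ?_ hmodK
  · exact fun h0 => hj0K (hj'.symm.trans h0)
  · exact fun h0 => hj1728K (hj'.symm.trans h0)

end Summit.Langlands.Langlands.Theorems.ModuliFieldDescentSplit
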